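import Literature.NumberTheory.LFunctions.Zhang2022.Section8ProfileSjPointwise
import HarnessLib

/-!
# Zhang (2022) §8 (8.11) for profile data: the CALCULUS of the main-term profile `Φ(z) = jetEx(z)·massEx(z)` —
# derivative, sizes, the `t = e^{zΛ}` substitution, and the engine profile `F(t) = Φ(log t/Λ)` on `[1, X+1]`

Topic `Literature/NumberTheory/LFunctions/Zhang2022` (Landau–Siegel audit tree; verdict-neutral). Y. Zhang, *Discrete mean
estimates and the Landau–Siegel zero*, arXiv:2211.02515v1 (2022) [Zhang2022LandauSiegel] — **an unrefereed manuscript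
under adjudication; nothing here asserts or denies its Theorems 1–2; no claim about Landau–Siegel zeros.** Cell
landau-siegel §D, crux K0 = stmt-Parity-20459 (row (S)), prover ls-knife-K0-p1 g2. Profile-data twin of
`Section8AbelProfiles` (the bounds `‖F‖ ≤ M`, `‖F′(t)‖ ≤ M′/t` that feed the range-sum engine
`Section8RangeEngine.weighted_sum_integral_eval` in «it follows by partial integration that (8.11)», p. 48): for a `C²` short
piece (`u, u′, u″` continuous on `[0,θ]`, `HasDerivAt u (u′ y) y`, `HasDerivAt u′ (u″ y) y` for `y < θ`),

* `prodProfile γ σ ν θ u u′ z = jetEx γ u u′ z · massEx σ ν θ u u′ z` and its derivative (`hasDerivAt_jetEx`,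
  `hasDerivAt_massEx`, `hasDerivAt_prodProfile`), sizes (`norm_prodProfile_le`, `norm_prodProfile'_le`), continuity;
* `engineProfile … Λ t = prodProfile … (log t/Λ)`: differentiable on `[1, X+1]` with `‖F‖ ≤ J₀K₀`, `‖F′(t)‖ ≤ (J₁K₀+J₀K₁)/(Λt)`
  once `log(X+1) < θΛ` (`engineProfile_hasDerivAt`, `norm_deriv_engineProfile_le`);
* `integral_engineProfile_eq` — `∫₁^{e^{bΛ}} F(t)dt/t = Λ∫₀^b Φ(z)dz` (`Zhang2022.integral_comp_exp_mul`).

## References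
* Y. Zhang, arXiv:2211.02515v1 (2022), §8 (8.11) p. 48 («it follows by partial integration»).
  [cite: Zhang2022LandauSiegel, §8 (8.11) p.48]
-/

noncomputable section

open Complex Real MeasureTheory Set intervalIntegral Filter
open scoped ComplexConjugate Topology

namespace Literature.NumberTheory.LFunctions.Zhang2022.DipoleRule

open Skeleton KnifeEdge

/-! ### The product profile -/

/-- **`Φ(z) = jetEx(z)·massEx(z)`** — the main-term profile of `A_j(n)B_j(d,r)/Π(d,r)` in the variable `z = log n/Λ`
(up to the factor `−χ(n)²Λ⁻²L′²`). [cite: Zhang2022LandauSiegel, §8 (8.11) p.48] -/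
def prodProfile (γ σ ν : ℂ) (θ : ℝ) (u u' : ℝ → ℂ) (z : ℝ) : ℂ := jetEx γ u u' z * massEx σ ν θ u u' z

/-- The derivative of the exact mass rule: `massEx′ = −ū″ + σū′ − νū`. [cite: Zhang2022LandauSiegel, §8 Lemma 8.4] -/
def massEx' (σ ν : ℂ) (u u' u'' : ℝ → ℂ) (z : ℝ) : ℂ := -conj (u'' z) + σ * conj (u' z) + ν * (-conj (u z))

/-- **`F(t) = Φ(log t/Λ)`** — the engine profile in the variable `t`. [cite: Zhang2022LandauSiegel, §8 (8.11) p.48] -/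
def engineProfile (γ σ ν : ℂ) (θ : ℝ) (u u' : ℝ → ℂ) (Λ : ℝ) (t : ℝ) : ℂ :=
  prodProfile γ σ ν θ u u' (Real.log t / Λ)

variable {γ σ ν : ℂ} {θ : ℝ} {u u' u'' : ℝ → ℂ}

/-! ### Continuity of a `C²` short piece -/

/-- `u` is continuous at every `y < θ` (it is differentiable there). [cite: Zhang2022LandauSiegel, §8 Lemma 8.2] -/
theorem continuousOn_Iio_of_hasDerivAt (hd : ∀ y : ℝ, y < θ → HasDerivAt u (u' y) y) : ContinuousOn u (Iio θ) :=
  fun y hy => (hd y hy).continuousAt.continuousWithinAt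

/-! ### Derivatives -/

/-- `jetEx′ = γu′ + u″` at `z < θ`. [cite: Zhang2022LandauSiegel, §8 Lemma 8.2] -/
theorem hasDerivAt_jetEx (hd : ∀ y : ℝ, y < θ → HasDerivAt u (u' y) y)
    (hd' : ∀ y : ℝ, y < θ → HasDerivAt u' (u'' y) y) {z : ℝ} (hz : z < θ) :
    HasDerivAt (jetEx γ u u') (γ * u' z + u'' z) z := by
  have h := ((hd z hz).const_mul γ).add (hd' z hz)
  exact h.congr_of_eventuallyEq (Eventually.of_forall fun y => by simp [jetEx])

/-- `d/dz ∫_z^θ ū = −ū(z)` at `0 ≤ z < θ` (FTC at the lower limit; `u` continuous on `[0,θ]` and at `z`).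
[cite: Zhang2022LandauSiegel, §8 Lemma 8.4] -/
theorem hasDerivAt_tailIntegral (hu : ContinuousOn u (Icc 0 θ)) (hd : ∀ y : ℝ, y < θ → HasDerivAt u (u' y) y)
    {z : ℝ} (hz0 : 0 ≤ z) (hz : z < θ) :
    HasDerivAt (fun y => ∫ x in y..θ, conj (u x)) (-conj (u z)) z := by
  have hcu : ContinuousOn (fun x => conj (u x)) (Icc 0 θ) := Complex.continuous_conj.comp_continuousOn hu
  have hint : IntervalIntegrable (fun x => conj (u x)) volume z θ :=
    ContinuousOn.intervalIntegrable (by rw [Set.uIcc_of_le hz.le]; exact hcu.mono (Icc_subset_Icc hz0 le_rfl))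
  have hcIio : ∀ x ∈ Iio θ, ContinuousAt (fun x => conj (u x)) x :=
    fun x hx => (Complex.continuous_conj.continuousAt).comp (hd x hx).continuousAt
  have hmeas : StronglyMeasurableAtFilter (fun x => conj (u x)) (𝓝 z) volume :=
    ContinuousAt.stronglyMeasurableAtFilter isOpen_Iio hcIio z hz
  exact intervalIntegral.integral_hasDerivAt_left hint hmeas (hcIio z hz)

/-- `massEx′ = −ū″ + σū′ − νū` at `0 ≤ z < θ`. [cite: Zhang2022LandauSiegel, §8 Lemma 8.4] -/
theorem hasDerivAt_massEx (hu : ContinuousOn u (Icc 0 θ)) (hd : ∀ y : ℝ, y < θ → HasDerivAt u (u' y) y)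
    (hd' : ∀ y : ℝ, y < θ → HasDerivAt u' (u'' y) y) {z : ℝ} (hz0 : 0 ≤ z) (hz : z < θ) :
    HasDerivAt (massEx σ ν θ u u') (massEx' σ ν u u' u'' z) z := by
  have h1 : HasDerivAt (fun y => conj (u' y)) (conj (u'' z)) z := by
    have h := (hd' z hz).star
    simpa using h
  have h2 : HasDerivAt (fun y => conj (u y)) (conj (u' z)) z := by
    have h := (hd z hz).star
    simpa using h
  have h3 := hasDerivAt_tailIntegral hu hd hz0 hz
  have h := (h1.neg.add (h2.const_mul σ)).add (h3.const_mul ν)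
  unfold massEx massEx'
  exact h

/-- **Product rule for `Φ`:** `Φ′ = jetEx′·massEx + jetEx·massEx′` at `0 ≤ z < θ`. [cite: Zhang2022LandauSiegel, §8 (8.11) p.48] -/
theorem hasDerivAt_prodProfile (hu : ContinuousOn u (Icc 0 θ)) (hd : ∀ y : ℝ, y < θ → HasDerivAt u (u' y) y)
    (hd' : ∀ y : ℝ, y < θ → HasDerivAt u' (u'' y) y) {z : ℝ} (hz0 : 0 ≤ z) (hz : z < θ) :
    HasDerivAt (prodProfile γ σ ν θ u u')
      ((γ * u' z + u'' z) * massEx σ ν θ u u' z + jetEx γ u u' z * massEx' σ ν u u' u'' z) z := by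
  have h := (hasDerivAt_jetEx (γ := γ) hd hd' hz).mul (hasDerivAt_massEx (σ := σ) (ν := ν) hu hd hd' hz0 hz)
  unfold prodProfile
  exact h

/-! ### Sizes -/

/-- `‖massEx′‖ ≤ B₂ + ‖σ‖B₁ + ‖ν‖B₀`. [cite: Zhang2022LandauSiegel, §8 Lemma 8.4] -/
theorem norm_massEx'_le {z B₀ B₁ B₂ : ℝ} (h0 : ‖u z‖ ≤ B₀) (h1 : ‖u' z‖ ≤ B₁) (h2 : ‖u'' z‖ ≤ B₂) :
    ‖massEx' σ ν u u' u'' z‖ ≤ B₂ + ‖σ‖ * B₁ + ‖ν‖ * B₀ := by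
  unfold massEx'
  calc ‖-conj (u'' z) + σ * conj (u' z) + ν * (-conj (u z))‖
      ≤ ‖-conj (u'' z)‖ + ‖σ * conj (u' z)‖ + ‖ν * (-conj (u z))‖ := norm_add₃_le
    _ ≤ B₂ + ‖σ‖ * B₁ + ‖ν‖ * B₀ := by
        rw [norm_neg, Complex.norm_conj, norm_mul, Complex.norm_conj, norm_mul, norm_neg, Complex.norm_conj]
        gcongr

/-- **`‖Φ(z)‖ ≤ J₀K₀`** on `[0,θ]`, `J₀ = ‖γ‖B₀ + B₁`, `K₀ = B₁ + ‖σ‖B₀ + ‖ν‖B₀θ`. [cite: Zhang2022LandauSiegel, §8 (8.11) p.48] -/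
theorem norm_prodProfile_le {z B₀ B₁ : ℝ} (hB0 : ∀ y ∈ Icc 0 θ, ‖u y‖ ≤ B₀)
    (hB1 : ∀ y ∈ Icc 0 θ, ‖u' y‖ ≤ B₁) (hz : z ∈ Icc 0 θ) :
    ‖prodProfile γ σ ν θ u u' z‖ ≤ (‖γ‖ * B₀ + B₁) * (B₁ + ‖σ‖ * B₀ + ‖ν‖ * (B₀ * θ)) := by
  unfold prodProfile
  rw [norm_mul]
  have hJ := norm_jetEx_le (γ := γ) (hB0 z hz) (hB1 z hz)
  have hK := norm_massEx_le (σ := σ) (ν := ν) hB0 hB1 hz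
  have hJ0 : 0 ≤ ‖γ‖ * B₀ + B₁ := le_trans (norm_nonneg _) hJ
  exact mul_le_mul hJ hK (norm_nonneg _) hJ0

/-- **`‖Φ′(z)‖ ≤ J₁K₀ + J₀K₁`** on `[0,θ)`, `J₁ = ‖γ‖B₁ + B₂`, `K₁ = B₂ + ‖σ‖B₁ + ‖ν‖B₀`.
[cite: Zhang2022LandauSiegel, §8 (8.11) p.48] -/
theorem norm_prodProfile'_le {z B₀ B₁ B₂ : ℝ} (hB0 : ∀ y ∈ Icc 0 θ, ‖u y‖ ≤ B₀)
    (hB1 : ∀ y ∈ Icc 0 θ, ‖u' y‖ ≤ B₁) (hB2 : ∀ y ∈ Icc 0 θ, ‖u'' y‖ ≤ B₂) (hz : z ∈ Icc 0 θ) :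
    ‖(γ * u' z + u'' z) * massEx σ ν θ u u' z + jetEx γ u u' z * massEx' σ ν u u' u'' z‖
      ≤ (‖γ‖ * B₁ + B₂) * (B₁ + ‖σ‖ * B₀ + ‖ν‖ * (B₀ * θ))
        + (‖γ‖ * B₀ + B₁) * (B₂ + ‖σ‖ * B₁ + ‖ν‖ * B₀) := by
  have hJ' : ‖γ * u' z + u'' z‖ ≤ ‖γ‖ * B₁ + B₂ := by
    calc ‖γ * u' z + u'' z‖ ≤ ‖γ * u' z‖ + ‖u'' z‖ := norm_add_le _ _
      _ ≤ ‖γ‖ * B₁ + B₂ := by rw [norm_mul]; gcongr; exacts [hB1 z hz, hB2 z hz]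
  have hK := norm_massEx_le (σ := σ) (ν := ν) hB0 hB1 hz
  have hJ := norm_jetEx_le (γ := γ) (hB0 z hz) (hB1 z hz)
  have hK' := norm_massEx'_le (σ := σ) (ν := ν) (hB0 z hz) (hB1 z hz) (hB2 z hz)
  have hJ0 : 0 ≤ ‖γ‖ * B₁ + B₂ := le_trans (norm_nonneg _) hJ'
  have hJ00 : 0 ≤ ‖γ‖ * B₀ + B₁ := le_trans (norm_nonneg _) hJ
  calc _ ≤ ‖(γ * u' z + u'' z) * massEx σ ν θ u u' z‖ + ‖jetEx γ u u' z * massEx' σ ν u u' u'' z‖ := norm_add_le _ _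
    _ ≤ _ := by
        rw [norm_mul, norm_mul]
        exact add_le_add (mul_le_mul hJ' hK (norm_nonneg _) hJ0) (mul_le_mul hJ hK' (norm_nonneg _) hJ00)

/-! ### Continuity of `Φ` on `[0,θ]` -/

/-- `z ↦ ∫_z^θ ū` is continuous on `[0,θ]`. [cite: Zhang2022LandauSiegel, §8 Lemma 8.4] -/
theorem continuousOn_tailIntegral (hu : ContinuousOn u (Icc 0 θ)) (hθ : 0 ≤ θ) :
    ContinuousOn (fun y => ∫ x in y..θ, conj (u x)) (Icc 0 θ) := by
  have hcu : ContinuousOn (fun x => conj (u x)) (Icc 0 θ) := Complex.continuous_conj.comp_continuousOn hu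
  have hint : IntegrableOn (fun x => conj (u x)) (Set.uIcc 0 θ) volume := by
    rw [Set.uIcc_of_le hθ]
    exact hcu.integrableOn_compact isCompact_Icc
  have h := intervalIntegral.continuousOn_primitive_interval_left hint
  rwa [Set.uIcc_of_le hθ] at h

/-- `Φ` is continuous on `[0,θ]`. [cite: Zhang2022LandauSiegel, §8 (8.11) p.48] -/
theorem continuousOn_prodProfile (hθ : 0 ≤ θ) (hu : ContinuousOn u (Icc 0 θ)) (hu' : ContinuousOn u' (Icc 0 θ)) :
    ContinuousOn (prodProfile γ σ ν θ u u') (Icc 0 θ) := by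
  have hcu : ContinuousOn (fun x => conj (u x)) (Icc 0 θ) := Complex.continuous_conj.comp_continuousOn hu
  have hcu' : ContinuousOn (fun x => conj (u' x)) (Icc 0 θ) := Complex.continuous_conj.comp_continuousOn hu'
  have hJ : ContinuousOn (jetEx γ u u') (Icc 0 θ) := by
    unfold jetEx; exact (continuousOn_const.mul hu).add hu'
  have hK : ContinuousOn (massEx σ ν θ u u') (Icc 0 θ) := by
    unfold massEx
    exact (hcu'.neg.add (continuousOn_const.mul hcu)).add (continuousOn_const.mul (continuousOn_tailIntegral hu hθ))
  unfold prodProfile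
  exact hJ.mul hK

/-- `Φ` is interval-integrable between points of `[0,θ]`. [cite: Zhang2022LandauSiegel, §8 (8.11) p.48] -/
theorem intervalIntegrable_prodProfile (hθ : 0 ≤ θ) (hu : ContinuousOn u (Icc 0 θ))
    (hu' : ContinuousOn u' (Icc 0 θ)) {a b : ℝ} (ha : a ∈ Icc 0 θ) (hb : b ∈ Icc 0 θ) :
    IntervalIntegrable (prodProfile γ σ ν θ u u') volume a b := by
  refine ContinuousOn.intervalIntegrable ((continuousOn_prodProfile (γ := γ) (σ := σ) (ν := ν) hθ hu hu').mono ?_)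
  intro x hx
  rw [Set.mem_uIcc] at hx
  rcases hx with h | h
  · exact ⟨ha.1.trans h.1, h.2.trans hb.2⟩
  · exact ⟨hb.1.trans h.1, h.2.trans ha.2⟩

/-! ### The engine profile `F(t) = Φ(log t/Λ)` -/

/-- **`F` is differentiable at `t > 0` with `0 ≤ log t/Λ < θ`:** `F′(t) = (t⁻¹/Λ)·Φ′(log t/Λ)`.
[cite: Zhang2022LandauSiegel, §8 (8.11) p.48] -/
theorem engineProfile_hasDerivAt (hu : ContinuousOn u (Icc 0 θ)) (hd : ∀ y : ℝ, y < θ → HasDerivAt u (u' y) y)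
    (hd' : ∀ y : ℝ, y < θ → HasDerivAt u' (u'' y) y) {Λ t : ℝ} (ht : 0 < t)
    (hz0 : 0 ≤ Real.log t / Λ) (hz : Real.log t / Λ < θ) :
    HasDerivAt (engineProfile γ σ ν θ u u' Λ)
      (((t⁻¹ / Λ : ℝ) : ℂ) *
        ((γ * u' (Real.log t / Λ) + u'' (Real.log t / Λ)) * massEx σ ν θ u u' (Real.log t / Λ)
          + jetEx γ u u' (Real.log t / Λ) * massEx' σ ν u u' u'' (Real.log t / Λ))) t := by
  have hΦ := hasDerivAt_prodProfile (γ := γ) (σ := σ) (ν := ν) hu hd hd' hz0 hz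
  have hg : HasDerivAt (fun s : ℝ => Real.log s / Λ) (t⁻¹ / Λ) t := (Real.hasDerivAt_log ht.ne').div_const Λ
  have h := hΦ.scomp t hg
  rw [Complex.real_smul] at h
  exact h

/-- **The engine hypotheses for `F` on `[1, X+1]`** (`Λ > 0`, `log(X+1) < θΛ`, `X ≥ 0`): differentiable, `‖F(t)‖ ≤ J₀K₀`,
`‖F′(t)‖ ≤ (J₁K₀ + J₀K₁)/Λ/t` (`X` is any real with `log(X+1) < θΛ`). [cite: Zhang2022LandauSiegel, §8 (8.11) p.48] -/
theorem engineProfile_bounds (hu : ContinuousOn u (Icc 0 θ)) (hd : ∀ y : ℝ, y < θ → HasDerivAt u (u' y) y)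
    (hd' : ∀ y : ℝ, y < θ → HasDerivAt u' (u'' y) y) {B₀ B₁ B₂ : ℝ} (hB0 : ∀ y ∈ Icc 0 θ, ‖u y‖ ≤ B₀)
    (hB1 : ∀ y ∈ Icc 0 θ, ‖u' y‖ ≤ B₁) (hB2 : ∀ y ∈ Icc 0 θ, ‖u'' y‖ ≤ B₂) {Λ X : ℝ} (hΛ : 0 < Λ)
    (hXθ : Real.log (X + 1) < θ * Λ) :
    (∀ t ∈ Icc 1 (X + 1), DifferentiableAt ℝ (engineProfile γ σ ν θ u u' Λ) t) ∧
    (∀ t ∈ Icc 1 (X + 1), ‖engineProfile γ σ ν θ u u' Λ t‖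
        ≤ (‖γ‖ * B₀ + B₁) * (B₁ + ‖σ‖ * B₀ + ‖ν‖ * (B₀ * θ))) ∧
    (∀ t ∈ Icc 1 (X + 1), ‖deriv (engineProfile γ σ ν θ u u' Λ) t‖
        ≤ (((‖γ‖ * B₁ + B₂) * (B₁ + ‖σ‖ * B₀ + ‖ν‖ * (B₀ * θ))
            + (‖γ‖ * B₀ + B₁) * (B₂ + ‖σ‖ * B₁ + ‖ν‖ * B₀)) / Λ) / t) := by
  -- every `t ∈ [1, X+1]` has `0 ≤ z_t < θ`
  have hzt : ∀ t ∈ Icc 1 (X + 1), 0 < t ∧ 0 ≤ Real.log t / Λ ∧ Real.log t / Λ < θ := by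
    intro t ht
    have ht0 : 0 < t := by linarith [ht.1]
    refine ⟨ht0, div_nonneg (Real.log_nonneg ht.1) hΛ.le, ?_⟩
    rw [div_lt_iff₀ hΛ]
    exact lt_of_le_of_lt (Real.log_le_log ht0 ht.2) hXθ
  refine ⟨fun t ht => ?_, fun t ht => ?_, fun t ht => ?_⟩
  · obtain ⟨ht0, hz0, hz⟩ := hzt t ht
    exact (engineProfile_hasDerivAt (γ := γ) (σ := σ) (ν := ν) hu hd hd' ht0 hz0 hz).differentiableAt
  · obtain ⟨ht0, hz0, hz⟩ := hzt t ht
    exact norm_prodProfile_le (γ := γ) (σ := σ) (ν := ν) hB0 hB1 ⟨hz0, hz.le⟩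
  · obtain ⟨ht0, hz0, hz⟩ := hzt t ht
    rw [(engineProfile_hasDerivAt (γ := γ) (σ := σ) (ν := ν) hu hd hd' ht0 hz0 hz).deriv, norm_mul,
      Complex.norm_real, Real.norm_of_nonneg (by positivity)]
    have hΦ' := norm_prodProfile'_le (γ := γ) (σ := σ) (ν := ν) hB0 hB1 hB2 ⟨hz0, hz.le⟩
    calc t⁻¹ / Λ * _ ≤ t⁻¹ / Λ * (((‖γ‖ * B₁ + B₂) * (B₁ + ‖σ‖ * B₀ + ‖ν‖ * (B₀ * θ))
            + (‖γ‖ * B₀ + B₁) * (B₂ + ‖σ‖ * B₁ + ‖ν‖ * B₀))) :=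
          mul_le_mul_of_nonneg_left hΦ' (by positivity)
      _ = _ := by field_simp

/-! ### The substitution `t = e^{zΛ}` -/

/-- **`∫₁^{e^{bΛ}} F(t) dt/t = Λ·∫₀^b Φ(z) dz`** (`Λ > 0`; `Zhang2022.integral_comp_exp_mul`).
[cite: Zhang2022LandauSiegel, §8 (8.11)–(8.12) p.48 («by the change of variable»)] -/
theorem integral_engineProfile_eq {Λ : ℝ} (hΛ : 0 < Λ) (b : ℝ) :
    ∫ t in (1:ℝ)..Real.exp (b * Λ), engineProfile γ σ ν θ u u' Λ t / t
      = (Λ : ℂ) * ∫ z in (0:ℝ)..b, prodProfile γ σ ν θ u u' z := by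
  have h := integral_comp_exp_mul hΛ.le (engineProfile γ σ ν θ u u' Λ) (a := 0) (b := b)
  rw [mul_zero, Real.exp_zero, mul_comm Λ b] at h
  rw [← h]
  congr 1
  refine intervalIntegral.integral_congr fun z _ => ?_
  simp only [engineProfile]
  rw [mul_comm Λ z, Real.log_exp, mul_div_cancel_right₀ _ hΛ.ne']

end Literature.NumberTheory.LFunctions.Zhang2022.DipoleRule

end
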